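import Mathlib
import Summits.QuantumFields.BalabanUV.Beta.FP.PerfectFFBlockRowSumTorus
import Summits.QuantumFields.BalabanUV.Beta.FP.CovarianceRowSumTower

/-!
# `BalabanUV.Beta.FP.PerfectFFBlockRowSum` — road «FP» (binder row D1), lane IR-5′, **THE (T0′) ROAD JUNCTION, FILE F4b: THE Γ-LETTER (T0′) IS
# UNCONDITIONAL** — for `d = 3`, odd `Lc > 1`, every `m ≥ 1`, every finite `Q ⊂ ℤ⁴`, every `x′ κ l`:
# `Σ_{y′∈Q} |KPerf Lc (sfStep Lc) (smStep 3 Lc) m x′ y′ (inl κ) (inl l)| ≤ A₀·(Lc^m)²` and the column twin `Σ_{q∈Q} |KPerf … q w …| ≤ A₀·(Lc^m)²`,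
# ONE `A₀(Lc)` for all `m` (= (1.115)'s first entry «|GJ| ≤ O(1)|J|» for the perfect ff block Γ_m in road units; the `hT0` letter of RHOA-3's
# `LegRemainderGaugeTerm.abs_rho_le` ∕ `_sub_left_le` ∕ `_sub_right_le`)

HONEST DEPENDENCY (page 1, mandatory): continuum YM on T⁴ ⇐ BetaPertH ∧ nine spine estimates (0/9 proved); BetaPertH ⇐ (D1) ∧ (D4) ∧
CAP+tail; G-an2-4 gates asym, D1 and NE2/3/4.  HONEST FRAMING (cell contract, verbatim): «discharging `BetaPertH` makes Bałaban's UV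
stability UNCONDITIONAL — a real constructive-QFT result; it is NOT the continuum limit and NOT the Clay problem.»  THIS MODULE is the g16∕g17 pattern
(`PeriodisationBound`, `PerfectFFBlockBounded` §4–§5) for FINITE ROW SUMS: a de-periodisation limit (`tendsto_periodisation`, [folklore]), F4a's torus-side
row-sum bound on the TOWER volumes `M_ν = 2Lc^k` (`N = Lc^{j+m} = nP P`, file 7's `exists_rowSum_Cov_tower` BY NAME), and gan24's limit
`RealRateKMHolds.tendsto_KTot_KPerf_holds`.  It cites nothing as a hypothesis, mints no `Prop`, has no `def`, 0 sorry; every analytic input is a kernel theorem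
of the tree (B4's Theorem on the torus — lit-balaban p38; (1.45)'s inverse decay — pv17; b05's (1.90) — nowhere here).  NOT hslice, NOT (ASYMP), NOT D1,
NOT BetaPertH, NOT continuum, NOT Clay; (T1′) (the column-difference letter) is NOT here.

ABSOLUTE RULE (cell charter, verbatim): «No internally-minted statement may enter as a cited fact. Every hypothesis is either kernel-proved in this
package or a verbatim quotation of a PUBLISHED theorem with page reference. The manuscript(s) under audit are NOT citable for their own disputed
steps — they are the thing under adjudication; programme-internal (2001/route/tribunal) claims are never citable.»

CONTENT.  §1 **`tendsto_periodisation`** (`w` summable, periods growing ⟹ `Σ_t w(x + P_k•t) → w(x)`), `sum_abs_le_of_periodisations` (finite-sum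
de-periodisation); §2 **`sum_abs_unitK_KTot_ff_le`** (every finite `(j, m)`: `Σ_{y′∈Q} |unitK (Lc^j) sm (KTot (Lc^(j+m)) (Lc^j)) x′ y′ ff| ≤ ½·(Lc^(j+m))²·(Lc^j)^{1−d}·C`
on the tower data of file 7); §3 ROAD (`d = 3`): **`exists_sum_abs_KPerf_ff_le`** — `∃ A₀ ∀ m ≥ 1 ∀ x′ κ l Q, Σ_{y′∈Q} |KPerf … m x′ y′ ff| ≤ A₀·(Lc^m)²`,
`KPerf_ff_symm`, **`exists_sum_abs_KPerf_ff_le_col`** (the column twin, RHOA-3's `hT0` shape).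
Unit `b2b-balaban-beta-d1-formalise-leaf-05` (gen 19), 2026-08-21; `LEAVES-FP.md` row «(T0′) ROAD JUNCTION F4b».  «(1.115) printed for `G`; Γ_m, the road units
and the proof are ours».
-/

noncomputable section

open scoped BigOperators Matrix ComplexConjugate
open Filter Topology

namespace Summit.QuantumFields.BalabanUV.Beta.FP.PerfectFFBlockRowSum

open Matrix
open Literature.MathematicalPhysics.QuantumFieldTheory.Balaban1983to89
open Literature.MathematicalPhysics.QuantumFieldTheory.Balaban1983to89.Beta
open AffineAveraging (Site)
open B5Prop11Plancherel (Tor fine)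
open FluctuationProjection (Cov)
open OneStepResolventKernel (Fib)
open OneStepKernelFamily (LegIdx legW)
open Summit.QuantumFields.BalabanUV.Beta.HessKerDressedUnits (unitK)
open Summit.QuantumFields.BalabanUV.Beta.GAN24.TorusPeriodise (pshift)
open Summit.QuantumFields.BalabanUV.Beta.GAN24.CombesThomas (sfStep smStep)
open Summit.QuantumFields.BalabanUV.Beta.GAN24.RealRateKMHolds (tendsto_KTot_KPerf_holds)
open Summit.QuantumFields.BalabanUV.Beta.FP.PerfectObjects (KTot)
open Summit.QuantumFields.BalabanUV.Beta.FP.PerfectObjectsT (KPerf)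
open Summit.QuantumFields.BalabanUV.Beta.FP.PeriodisationBound (add_pshift_not_mem abs_tsum_pshift_sub_le)
open Summit.QuantumFields.BalabanUV.Beta.FP.PerfectFFBlockBounded (summable_unitK_KTot_ff)
open Summit.QuantumFields.BalabanUV.Beta.FP.PerfectFFBlockRowSumTorus (unitK_KTot_ff_symm sum_abs_tsum_unitK_KTot_ff_pshift_le)
open Summit.QuantumFields.BalabanUV.Beta.FP.CovarianceRowSumTower (exists_rowSum_Cov_tower)
open B5SiteBridgeP12 (nP MP one_le_nP)

/-! ## §1 De-periodisation of finite sums -/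

section Deperiodise

variable {D : ℕ}

/-- [folklore] **THE PERIODISATIONS CONVERGE TO THE CENTRE TERM**: `w` summable on `ℤ^D`, periods `P_k ≥ 1` growing in every direction ⟹
`Σ_t w(x + P_k•t) → w(x)` (the nonzero shifts leave every finite set; the tail of `|w|` is small — `abs_tsum_pshift_sub_le`). -/
theorem tendsto_periodisation {w : Site D → ℝ} (hw : Summable w) (x : Site D) {P : ℕ → Fin D → ℕ} (hP1 : ∀ k ν, 1 ≤ P k ν)
    (hP : ∀ R : ℕ, ∀ᶠ k in atTop, ∀ ν, R ≤ P k ν) :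
    Tendsto (fun k => ∑' t : Site D, w (x + pshift (P k) t)) atTop (𝓝 (w x)) := by
  classical
  rw [Metric.tendsto_atTop]
  intro ε hε
  have htail := tendsto_tsum_compl_atTop_zero (fun z : Site D => |w z|)
  obtain ⟨F, hFε⟩ : ∃ F : Finset (Site D), ∑' z : {z // z ∉ F}, |w z| < ε := (htail.eventually (gt_mem_nhds hε)).exists
  obtain ⟨R, hR⟩ : ∃ R : ℕ, ∀ z ∈ F, ∀ ν, |z ν - x ν| < R := by
    refine ⟨F.sup (fun z => Finset.univ.sup fun ν => (z ν - x ν).natAbs) + 1, fun z hz ν => ?_⟩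
    have h1 : (z ν - x ν).natAbs ≤ Finset.univ.sup fun ν => (z ν - x ν).natAbs := Finset.le_sup (f := fun ν => (z ν - x ν).natAbs) (Finset.mem_univ ν)
    have h2 : (Finset.univ.sup fun ν => (z ν - x ν).natAbs) ≤ F.sup (fun z => Finset.univ.sup fun ν => (z ν - x ν).natAbs) :=
      Finset.le_sup (f := fun z => Finset.univ.sup fun ν => (z ν - x ν).natAbs) hz
    have h3 : |z ν - x ν| = ((z ν - x ν).natAbs : ℤ) := (Int.natCast_natAbs _).symm
    rw [h3]
    push_cast
    omega
  obtain ⟨K, hK⟩ := eventually_atTop.mp (hP R)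
  refine ⟨K, fun k hk => ?_⟩
  have hnot : ∀ t : Site D, t ≠ 0 → x + pshift (P k) t ∉ F := fun t ht => add_pshift_not_mem (hK k hk) x F hR ht
  have hdiff := abs_tsum_pshift_sub_le hw x (hP1 k) F hnot
  rw [Real.dist_eq]
  exact lt_of_le_of_lt hdiff hFε

/-- [folklore] **FINITE-SUM DE-PERIODISATION**: for a finite family `w_a` (`a ∈ Q`) of summable kernels and centres `x_a`, an eventual bound
`Σ_{a∈Q} |Σ_t w_a(x_a + P_k•t)| ≤ B` along growing periods gives `Σ_{a∈Q} |w_a(x_a)| ≤ B`. -/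
theorem sum_abs_le_of_periodisations {α : Type*} (Q : Finset α) {w : α → Site D → ℝ} (hw : ∀ a, Summable (w a)) (x : α → Site D)
    {P : ℕ → Fin D → ℕ} (hP1 : ∀ k ν, 1 ≤ P k ν) (hP : ∀ R : ℕ, ∀ᶠ k in atTop, ∀ ν, R ≤ P k ν) {B : ℝ}
    (hB : ∀ᶠ k in atTop, ∑ a ∈ Q, |∑' t : Site D, w a (x a + pshift (P k) t)| ≤ B) : ∑ a ∈ Q, |w a (x a)| ≤ B := by
  have ht : Tendsto (fun k => ∑ a ∈ Q, |∑' t : Site D, w a (x a + pshift (P k) t)|) atTop (𝓝 (∑ a ∈ Q, |w a (x a)|)) :=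
    tendsto_finsetSum Q fun a _ => (tendsto_periodisation (hw a) (x a) hP1 hP).abs
  exact le_of_tendsto ht hB

end Deperiodise

/-! ## §2 Every finite `(j, m)` on the tower volumes -/

section Finite

variable {d : ℕ}
set_option maxHeartbeats 400000 in
/-- [our bookkeeping] **ROW SUMS OF THE ff BLOCK OF THE UNIT-RESCALED (j,m)-RESOLVENT**: for odd `Lc > 1`, `K = j + m ≥ 1` and the covariance letter `C`
of file 7 on the tower tori (`N = Lc^K`, `M_ν = 2Lc^k`): for every finite `Q`, `x′ κ l` and unit `sm`,
`Σ_{y′∈Q} |unitK (Lc^j) sm (KTot (Lc^K) (Lc^j)) x′ y′ ff| ≤ ((Lc^j)²·(Lc^K)²∕2)·legW·Lc^j·C` — F4a's torus bound on the tori `k → ∞`, de-periodised by §1. -/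
theorem sum_abs_unitK_KTot_ff_le {Lc : ℕ} (hLc : Odd Lc ∧ 1 < Lc) {C : ℝ}
    (hC : ∀ P : Params, P.d = d + 1 → P.L = Lc → 1 ≤ P.K →
      ∀ i : Tor (fine (nP P) (MP P)) × Fin P.d, ∑ j, ‖Cov (nP P) (one_le_nP P) (MP P) 1 one_pos i j‖ ≤ C)
    (j m : ℕ) (hjm : 1 ≤ j + m) (sm : ℝ) (x' : Site (d + 1)) (κ l : Fin (d + 1)) (Q : Finset (Site (d + 1))) :
    haveI : NeZero (Lc ^ (j + m)) := ⟨pow_ne_zero _ (by have := hLc.2; omega)⟩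
    ∑ y' ∈ Q, |unitK ((Lc ^ j : ℕ) : ℝ) sm (KTot (d := d) (Lc ^ (j + m)) (Lc ^ j)) x' y' (Sum.inl κ) (Sum.inl l)|
      ≤ (((Lc ^ j : ℕ) : ℝ) ^ 2 * ((Lc ^ (j + m) : ℕ) : ℝ) ^ 2 / 2) * (legW d (Lc ^ j) (Sum.inl l : Fib d) * ((Lc ^ j : ℕ) * C)) := by
  haveI : NeZero (Lc ^ (j + m)) := ⟨pow_ne_zero _ (by have := hLc.2; omega)⟩
  have hLc1 : 1 ≤ Lc := hLc.2.le
  have hMb : 1 ≤ Lc ^ j := Nat.one_le_pow _ _ hLc1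
  have hn : 1 ≤ Lc ^ m := Nat.one_le_pow _ _ hLc1
  -- the tower volumes `P k = ⟨d+1, Lc, k, j+m⟩`, coarse periods `Lc^m · 2Lc^k`
  let Pk : ℕ → Params := fun k => ⟨d + 1, Lc, k, j + m, Nat.succ_pos d, hLc⟩
  have hnP : ∀ k, nP (Pk k) = Lc ^ (j + m) := fun k => rfl
  let Pd : ℕ → Fin (d + 1) → ℕ := fun k => fine (Lc ^ m) (MP (Pk k))
  have hPd1 : ∀ k ν, 1 ≤ Pd k ν := fun k ν => by
    show 1 ≤ Lc ^ m * (2 * Lc ^ k)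
    exact Nat.one_le_iff_ne_zero.mpr (Nat.mul_ne_zero (by positivity) (by positivity))
  have hPgrow : ∀ R : ℕ, ∀ᶠ k in atTop, ∀ ν, R ≤ Pd k ν := fun R => by
    refine (eventually_ge_atTop R).mono fun k hk ν => ?_
    show R ≤ Lc ^ m * (2 * Lc ^ k)
    calc R ≤ k := hk
      _ ≤ Lc ^ k := (Nat.lt_pow_self hLc.2).le
      _ ≤ 2 * Lc ^ k := Nat.le_mul_of_pos_left _ two_pos
      _ ≤ Lc ^ m * (2 * Lc ^ k) := Nat.le_mul_of_pos_left _ (by positivity)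
  -- the torus-side bound holds for all large `k` (separation of `Q` against the fine periods `Lc^(j+m)·2Lc^k`)
  obtain ⟨R, hR⟩ : ∃ R : ℕ, ∀ y₁ ∈ Q, ∀ y₂ ∈ Q, ∀ ν, |y₁ ν - y₂ ν| ≤ R := by
    classical
    refine ⟨Q.sup (fun y₁ => Q.sup fun y₂ => Finset.univ.sup fun ν => (y₁ ν - y₂ ν).natAbs), fun y₁ h₁ y₂ h₂ ν => ?_⟩
    have h1 : (y₁ ν - y₂ ν).natAbs ≤ Finset.univ.sup fun ν => (y₁ ν - y₂ ν).natAbs := Finset.le_sup (f := fun ν => (y₁ ν - y₂ ν).natAbs) (Finset.mem_univ ν)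
    have h2 : (Finset.univ.sup fun ν => (y₁ ν - y₂ ν).natAbs) ≤ Q.sup fun y₂ => Finset.univ.sup fun ν => (y₁ ν - y₂ ν).natAbs :=
      Finset.le_sup (f := fun y₂ => Finset.univ.sup fun ν => (y₁ ν - y₂ ν).natAbs) h₂
    have h3 : (Q.sup fun y₂ => Finset.univ.sup fun ν => (y₁ ν - y₂ ν).natAbs) ≤ Q.sup (fun y₁ => Q.sup fun y₂ => Finset.univ.sup fun ν => (y₁ ν - y₂ ν).natAbs) :=
      Finset.le_sup (f := fun y₁ => Q.sup fun y₂ => Finset.univ.sup fun ν => (y₁ ν - y₂ ν).natAbs) h₁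
    have h4 : |y₁ ν - y₂ ν| = ((y₁ ν - y₂ ν).natAbs : ℤ) := (Int.natCast_natAbs _).symm
    rw [h4]
    exact_mod_cast h1.trans (h2.trans h3)
  have hB : ∀ᶠ k in atTop, ∑ y' ∈ Q, |∑' t : Site (d + 1),
      unitK ((Lc ^ j : ℕ) : ℝ) sm (KTot (d := d) (Lc ^ (j + m)) (Lc ^ j)) x' (y' + pshift (Pd k) t) (Sum.inl κ) (Sum.inl l)|
        ≤ (((Lc ^ j : ℕ) : ℝ) ^ 2 * ((Lc ^ (j + m) : ℕ) : ℝ) ^ 2 / 2) * (legW d (Lc ^ j) (Sum.inl l : Fib d) * ((Lc ^ j : ℕ) * C)) := by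
    refine (eventually_ge_atTop ((Lc ^ j) * R + Lc ^ j)).mono fun k hk => ?_
    have hsep : ∀ y₁ ∈ Q, ∀ y₂ ∈ Q, ∀ ν, ((Lc ^ j : ℕ) : ℤ) * |y₁ ν - y₂ ν| + (Lc ^ j : ℕ) ≤ fine (nP (Pk k)) (MP (Pk k)) ν := by
      intro y₁ h₁ y₂ h₂ ν
      have h1 := hR y₁ h₁ y₂ h₂ ν
      have h2 : ((Lc ^ j : ℕ) : ℤ) * (R : ℤ) + ((Lc ^ j : ℕ) : ℤ) ≤ ((fine (nP (Pk k)) (MP (Pk k)) ν : ℕ) : ℤ) := by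
        have : Lc ^ j * R + Lc ^ j ≤ fine (nP (Pk k)) (MP (Pk k)) ν := by
          show Lc ^ j * R + Lc ^ j ≤ Lc ^ (j + m) * (2 * Lc ^ k)
          calc Lc ^ j * R + Lc ^ j ≤ k := hk
            _ ≤ Lc ^ k := (Nat.lt_pow_self hLc.2).le
            _ ≤ 2 * Lc ^ k := Nat.le_mul_of_pos_left _ two_pos
            _ ≤ Lc ^ (j + m) * (2 * Lc ^ k) := Nat.le_mul_of_pos_left _ (by positivity)
        exact_mod_cast this
      exact le_trans (add_le_add_left (mul_le_mul_of_nonneg_left h1 (by positivity)) _) h2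
    have h := sum_abs_tsum_unitK_KTot_ff_pshift_le (nP (Pk k)) (one_le_nP (Pk k)) (MP (Pk k)) (Lc ^ j) (Lc ^ m) hMb
      (by rw [hnP, pow_add, mul_comm]) (hC (Pk k) rfl rfl hjm) sm x' κ l Q hsep
    exact h
  exact sum_abs_le_of_periodisations Q (fun y' => summable_unitK_KTot_ff (Lc ^ (j + m)) (Lc ^ j) hMb _ sm x' κ l) (fun y' => y') hPd1 hPgrow hB

end Finite

/-! ## §3 The road (`d = 3`): the perfect ff block, both variables -/

section Road

variable {Lc : ℕ} [NeZero Lc]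

/-- [our object] **(T0′), ROW FORM**: for odd `Lc > 1` there is ONE `A₀` with
`Σ_{y′∈Q} |KPerf Lc (sfStep Lc) (smStep 3 Lc) m x′ y′ (inl κ) (inl l)| ≤ A₀·(Lc^m)²` for every `m ≥ 1`, finite `Q ⊂ ℤ⁴`, `x′ κ l`
(`A₀ = C∕2`, `C` = file 7's covariance letter at `d = 3`, `a = 1`; `(Lc^j)²·(Lc^(j+m))²∕2 · (Lc^j)^{−5} · Lc^j = (Lc^m)²∕2`). -/
theorem exists_sum_abs_KPerf_ff_le (hLc : Odd Lc ∧ 1 < Lc) :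
    ∃ A₀ : ℝ, ∀ m : ℕ, 1 ≤ m → ∀ (x' : Site (3 + 1)) (κ l : Fin (3 + 1)) (Q : Finset (Site (3 + 1))),
      ∑ y' ∈ Q, |KPerf (d := 3) Lc (sfStep Lc) (smStep 3 Lc) m x' y' (Sum.inl κ) (Sum.inl l)| ≤ A₀ * ((Lc : ℝ) ^ m) ^ 2 := by
  obtain ⟨C, hC⟩ := exists_rowSum_Cov_tower 3 Lc hLc one_pos
  have hLc2 : 2 ≤ Lc := hLc.2
  refine ⟨C / 2, fun m hm x' κ l Q => ?_⟩
  have ht : Tendsto (fun j => ∑ y' ∈ Q, |unitK (sfStep Lc j) (smStep 3 Lc j) (KTot (d := 3) (Lc ^ (j + m)) (Lc ^ j)) x' y' (Sum.inl κ) (Sum.inl l)|)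
      atTop (𝓝 (∑ y' ∈ Q, |KPerf (d := 3) Lc (sfStep Lc) (smStep 3 Lc) m x' y' (Sum.inl κ) (Sum.inl l)|)) :=
    tendsto_finsetSum Q fun y' _ => (tendsto_KTot_KPerf_holds hLc2 hm x' y' (Sum.inl κ) (Sum.inl l)).abs
  refine le_of_tendsto' ht fun j => ?_
  have hsf : sfStep Lc j = ((Lc ^ j : ℕ) : ℝ) := by simp [sfStep]
  have hjm : 1 ≤ j + m := by omega
  have h := sum_abs_unitK_KTot_ff_le (d := 3) hLc hC j m hjm (smStep 3 Lc j) x' κ l Q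
  rw [hsf]
  refine h.trans (le_of_eq ?_)
  have hL : (Lc : ℝ) ≠ 0 := by exact_mod_cast (NeZero.ne Lc)
  simp only [legW]
  push_cast
  field_simp
  ring

/-- [our object] **THE PERFECT ff BLOCK IS SYMMETRIC**: `KPerf … m x′ y′ (inl κ) (inl l) = KPerf … m y′ x′ (inl l) (inl κ)` (limits of F4a's symmetric finite blocks). -/
theorem KPerf_ff_symm (hLc : 2 ≤ Lc) {m : ℕ} (hm : 1 ≤ m) (x' y' : Site (3 + 1)) (κ l : Fin (3 + 1)) :
    KPerf (d := 3) Lc (sfStep Lc) (smStep 3 Lc) m x' y' (Sum.inl κ) (Sum.inl l)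
      = KPerf (d := 3) Lc (sfStep Lc) (smStep 3 Lc) m y' x' (Sum.inl l) (Sum.inl κ) := by
  have h1 := tendsto_KTot_KPerf_holds hLc hm x' y' (Sum.inl κ) (Sum.inl l)
  have h2 := tendsto_KTot_KPerf_holds hLc hm y' x' (Sum.inl l) (Sum.inl κ)
  simp_rw [unitK_KTot_ff_symm _ _ _ _ x' y' κ l] at h1
  exact tendsto_nhds_unique h1 h2

/-- [our object] **(T0′), COLUMN FORM (RHOA-3's `hT0` shape)**: for odd `Lc > 1` there is ONE `A₀` with
`Σ_{q∈Q} |KPerf Lc (sfStep Lc) (smStep 3 Lc) m q w (inl κ) (inl l)| ≤ A₀·(Lc^m)²` for every `m ≥ 1`, finite `Q ⊂ ℤ⁴`, `w κ l`. -/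
theorem exists_sum_abs_KPerf_ff_le_col (hLc : Odd Lc ∧ 1 < Lc) :
    ∃ A₀ : ℝ, ∀ m : ℕ, 1 ≤ m → ∀ (w : Site (3 + 1)) (κ l : Fin (3 + 1)) (Q : Finset (Site (3 + 1))),
      ∑ q ∈ Q, |KPerf (d := 3) Lc (sfStep Lc) (smStep 3 Lc) m q w (Sum.inl κ) (Sum.inl l)| ≤ A₀ * ((Lc : ℝ) ^ m) ^ 2 := by
  obtain ⟨A₀, h⟩ := exists_sum_abs_KPerf_ff_le hLc
  refine ⟨A₀, fun m hm w κ l Q => ?_⟩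
  have hLc2 : 2 ≤ Lc := hLc.2
  simp_rw [KPerf_ff_symm hLc2 hm _ w κ l]
  exact h m hm w l κ Q

end Road

end Summit.QuantumFields.BalabanUV.Beta.FP.PerfectFFBlockRowSum

end
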